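import Summits.FinalStateConjecture.FinalStateConjecture.Theorems.EIHFluxBalanceInertialRecessionVirialFamily
import Summits.FinalStateConjecture.FinalStateConjecture.Theorems.EIHFluxBalanceInertialRecessionVirialIdentity
import Summits.FinalStateConjecture.FinalStateConjecture.Theorems.EIHFluxBalanceInertialRecessionVirialStep

/-!
# Route EIHFluxBalance — crux `InertialRecession`, abstract endgame for general `N`:
# node increments along a block, the scale-matched flux bound, moving centres

Helper file for the crux `stmt-FinalStateConjecture-10166` (virial route; `InertialRecession_seat0_session8_note.md` §A(iv)).
Mathlib-only.

* `node_increment` — from a DIGESTED NODE LAW (the conclusion of `clusterLaw_constPath` in vector form for `2δ`-clear constant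
  windows inside the cone of radius at least `min (r_min/(2(1+3δ))) (c₀t)`, with the threshold clause already discharged), a set `B` that qualifies at level `ℓ` at the block start
  `s` keeps, along its whole block (`2^{ℓ−k₀}` steps), its momentum vector within
  `3 (C 2^{ℓ−k₀} h R^{-3/2} + ζ(t_s) + ζ(t))` of its value at `t_s`, where `R = min (g/(1+3δ), c₀ t_s)` is its window radius.
* `scale_flux_le` — the scale matching: `x (min(ga, b))^{-3/2} ≤ a^{-3/2} g^{-1/2} + G b^{-3/2}` for `0 < x ≤ g ≤ G`
  (lever `≍ 2^ℓ ≤ g` against flux `R^{-3/2}`, both cases of the minimum).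
* `norm_centre_sub_centre_le_of_move` — rest-mass centres move no faster than the bodies.
-/

noncomputable section

open Finset

namespace Summit.FinalStateConjecture.FinalStateConjecture.Theorems.SublinearIsFree.Virial

open Literature.Geometry.Lorentzian

variable {N : ℕ}

/-! ### Moving centres -/

/-- If every member of a nonempty `A` moves by at most `μ` between two configurations, so does the rest-mass centre. [folklore] -/
theorem norm_centre_sub_centre_le_of_move {ξ ξ' : Fin N → E3} {M : Fin N → ℝ} (hM : ∀ i, 0 < M i) {A : Finset (Fin N)}
    (hA : A.Nonempty) {μ : ℝ} (hμ : ∀ x ∈ A, ‖ξ' x - ξ x‖ ≤ μ) :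
    ‖(∑ k ∈ A, M k)⁻¹ • ∑ k ∈ A, M k • ξ' k - (∑ k ∈ A, M k)⁻¹ • ∑ k ∈ A, M k • ξ k‖ ≤ μ := by
  rw [restMassCentre_sub]
  exact norm_restMassAvg_le A M hM hA (fun k ↦ ξ' k - ξ k) hμ

/-! ### The scale-matched flux bound -/

/-- `x^{3/2} = x √x` for `x ≥ 0`. [folklore] -/
theorem rpow_three_halves_eq (x : ℝ) (hx : 0 ≤ x) : x ^ (3 / 2 : ℝ) = x * √x := by
  rw [show (3 / 2 : ℝ) = 1 + 1 / 2 by norm_num, Real.rpow_add' hx (by norm_num), Real.rpow_one, Real.sqrt_eq_rpow]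

/-- **Scale matching.** For `0 < x ≤ g ≤ G` and `a, b > 0`:
`x · (min (g a) b)^{-3/2} ≤ a^{-3/2} (√g)⁻¹ + G · b^{-3/2}`. [folklore] -/
theorem scale_flux_le {x g G a b : ℝ} (hx : 0 < x) (hxg : x ≤ g) (hgG : g ≤ G) (ha : 0 < a) (hb : 0 < b) :
    x * ((min (g * a) b) ^ (3 / 2 : ℝ))⁻¹ ≤ ((a ^ (3 / 2 : ℝ))⁻¹) * (√g)⁻¹ + G * (b ^ (3 / 2 : ℝ))⁻¹ := by
  have hg : 0 < g := hx.trans_le hxg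
  have hga : 0 < g * a := mul_pos hg ha
  have hterm2 : 0 ≤ G * (b ^ (3 / 2 : ℝ))⁻¹ := mul_nonneg (hg.le.trans hgG) (by positivity)
  have hterm1 : 0 ≤ ((a ^ (3 / 2 : ℝ))⁻¹) * (√g)⁻¹ := by positivity
  rcases le_total (g * a) b with hcase | hcase
  · rw [min_eq_left hcase]
    -- `x (ga)^{-3/2} ≤ g (ga)^{-3/2} = a^{-3/2} g^{-1/2}`
    have h1 : x * ((g * a) ^ (3 / 2 : ℝ))⁻¹ ≤ g * ((g * a) ^ (3 / 2 : ℝ))⁻¹ :=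
      mul_le_mul_of_nonneg_right hxg (by positivity)
    have h2 : g * ((g * a) ^ (3 / 2 : ℝ))⁻¹ = ((a ^ (3 / 2 : ℝ))⁻¹) * (√g)⁻¹ := by
      rw [Real.mul_rpow hg.le ha.le, rpow_three_halves_eq g hg.le]
      have hsg : 0 < √g := Real.sqrt_pos.mpr hg
      field_simp
    linarith
  · rw [min_eq_right hcase]
    have h1 : x * (b ^ (3 / 2 : ℝ))⁻¹ ≤ G * (b ^ (3 / 2 : ℝ))⁻¹ :=
      mul_le_mul_of_nonneg_right (hxg.trans hgG) (by positivity)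
    linarith

/-! ### Node increments along a block -/

/-- **The node window is admissible for the whole block.** For a set `B` qualifying at level `ℓ` at the grid time
`t = T + s h` (`(D, g)`-controlled, `ΛD < g`, `2^ℓ ≤ g`, near outsider), any member `x`, and the radius
`R = min (g/(1+3δ)) (c₀ t)`: `R > 0`, `R ≤ c₀ t`, `min (r_min(t)/(2(1+3δ))) (c₀t) ≤ R`, the centre `ξₓ(t)` is in the cone, members are
within `(1 − 2δ)R`, non-members beyond `(1 + 2δ)R`, and the block duration `2^{ℓ−k₀} h` is at most `δR`. [folklore] -/
theorem node_window (ξ : Fin N → ℝ → E3) {κ δ c₀ Λ h T : ℝ} {k₀ : ℕ} (rmin : ℝ → ℝ)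
    (hδ : 0 < δ) (hδ1 : δ ≤ 1 / 10) (hΛ2 : 2 ≤ Λ) (hΛκ : 2 * κ ^ 2 ≤ Λ * ((1 - 2 * δ) * c₀)) (hc₀ : 0 < c₀)
    (hh0 : 0 ≤ h) (hT : 0 < T)
    (hδ₁a : h / 2 ^ k₀ ≤ δ / (1 + 3 * δ)) (hδ₁b : h / 2 ^ k₀ * (2 * κ ^ 2) ≤ δ * c₀)
    (hcone : ∀ (m : ℕ) (x : Fin N), ‖ξ x (T + m * h)‖ ≤ κ ^ 2 * (T + m * h))
    (hrmin : ∀ (m : ℕ) (x y : Fin N), x ≠ y → rmin (T + m * h) ≤ ‖ξ x (T + m * h) - ξ y (T + m * h)‖)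
    {B : Finset (Fin N)} {x : Fin N} (hx : x ∈ B) {ℓ : ℕ} (hk₀ : k₀ ≤ ℓ) {s : ℕ} {D g : ℝ}
    (hD : ∀ x ∈ B, ∀ y ∈ B, ‖ξ x (T + s * h) - ξ y (T + s * h)‖ ≤ D)
    (hg : ∀ x ∈ B, ∀ z ∈ univ \ B, g ≤ ‖ξ x (T + s * h) - ξ z (T + s * h)‖)
    (hnear : ∃ x₀ ∈ B, ∃ z₀ ∈ univ \ B, ‖ξ x₀ (T + s * h) - ξ z₀ (T + s * h)‖ < 2 * g)
    (hgap : Λ * D < g) (hℓg : (2 : ℝ) ^ ℓ ≤ g) :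
    0 < min (g / (1 + 3 * δ)) (c₀ * (T + s * h)) ∧
    min (g / (1 + 3 * δ)) (c₀ * (T + s * h)) ≤ c₀ * (T + s * h) ∧
    min (rmin (T + s * h) / (2 * (1 + 3 * δ))) (c₀ * (T + s * h)) ≤ min (g / (1 + 3 * δ)) (c₀ * (T + s * h)) ∧
    ‖ξ x (T + s * h)‖ ≤ κ ^ 2 * (T + s * h) ∧
    (∀ j ∈ B, ‖ξ j (T + s * h) - ξ x (T + s * h)‖ ≤ (1 - 2 * δ) * min (g / (1 + 3 * δ)) (c₀ * (T + s * h))) ∧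
    (∀ j ∉ B, (1 + 2 * δ) * min (g / (1 + 3 * δ)) (c₀ * (T + s * h)) ≤ ‖ξ j (T + s * h) - ξ x (T + s * h)‖) ∧
    (2 : ℝ) ^ (ℓ - k₀) * h ≤ δ * min (g / (1 + 3 * δ)) (c₀ * (T + s * h)) := by
  set t : ℝ := T + s * h with ht
  have ht0 : 0 < t := by rw [ht]; positivity
  have hpos2 : (0 : ℝ) < 2 ^ ℓ := pow_pos (by norm_num) ℓ
  have hg0 : 0 < g := hpos2.trans_le hℓg
  set R : ℝ := min (g / (1 + 3 * δ)) (c₀ * t) with hR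
  have h13 : 0 < 1 + 3 * δ := by linarith
  have h12 : 0 < 1 - 2 * δ := by linarith
  have hR0 : 0 < R := lt_min (div_pos hg0 h13) (mul_pos hc₀ ht0)
  have hRc₀ : R ≤ c₀ * t := min_le_right _ _
  have hRg : R ≤ g / (1 + 3 * δ) := min_le_left _ _
  obtain ⟨x₀, hx₀, z₀, hz₀, hxz⟩ := hnear
  have hg2 : g ≤ 2 * κ ^ 2 * t := by
    have h0 := hg x₀ hx₀ z₀ hz₀
    have h1' : ‖ξ x₀ t - ξ z₀ t‖ ≤ ‖ξ x₀ t‖ + ‖ξ z₀ t‖ := norm_sub_le _ _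
    have h2' := hcone s x₀
    have h3' := hcone s z₀
    rw [← ht] at h2' h3'
    linarith
  refine ⟨hR0, hRc₀, ?_, ?_, ?_, ?_, ?_⟩
  · refine min_le_min ?_ le_rfl
    have hzx : x₀ ≠ z₀ := by
      intro heq; subst heq
      exact (Finset.mem_sdiff.mp hz₀).2 hx₀
    have h0 := hrmin s x₀ z₀ hzx
    rw [← ht] at h0
    have h2g : rmin t < 2 * g := h0.trans_lt hxz
    rw [div_le_div_iff₀ (by positivity) h13]
    nlinarith
  · have := hcone s x; rwa [← ht] at this
  · intro j hj
    have hDg : D ≤ g / Λ := by rw [le_div_iff₀ (by linarith)]; linarith [mul_comm Λ D]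
    refine (hD j hj x hx).trans (hDg.trans ?_)
    rcases le_total (g / (1 + 3 * δ)) (c₀ * t) with hc | hc
    · have hRv : R = g / (1 + 3 * δ) := by rw [hR, min_eq_left hc]
      rw [hRv, div_le_iff₀ (by linarith)]
      -- `g ≤ Λ (1−2δ) g/(1+3δ)` since `Λ(1−2δ) ≥ 2·0.8 ≥ 1+3δ`
      have hq : 1 + 3 * δ ≤ (1 - 2 * δ) * Λ := by nlinarith
      have : (1 - 2 * δ) * (g / (1 + 3 * δ)) * Λ = g * (((1 - 2 * δ) * Λ) / (1 + 3 * δ)) := by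
        field_simp
      rw [this]
      have h1' : 1 ≤ ((1 - 2 * δ) * Λ) / (1 + 3 * δ) := by rw [le_div_iff₀ h13]; linarith
      nlinarith
    · have hRv : R = c₀ * t := by rw [hR, min_eq_right hc]
      rw [hRv, div_le_iff₀ (by linarith)]
      nlinarith
  · intro j hj
    have h0 := hg x hx j (Finset.mem_sdiff.mpr ⟨Finset.mem_univ _, hj⟩)
    rw [norm_sub_rev] at h0
    refine le_trans ?_ h0
    calc (1 + 2 * δ) * R ≤ (1 + 2 * δ) * (g / (1 + 3 * δ)) := mul_le_mul_of_nonneg_left hRg (by linarith)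
      _ ≤ g := by rw [mul_div_assoc', div_le_iff₀ h13]; nlinarith
  · have hblk : (2 : ℝ) ^ (ℓ - k₀) * h = 2 ^ ℓ * (h / 2 ^ k₀) := by
      obtain ⟨e, rfl⟩ := Nat.exists_eq_add_of_le hk₀
      rw [Nat.add_sub_cancel_left, pow_add]; field_simp
    have hδ₁0 : 0 ≤ h / 2 ^ k₀ := by positivity
    rw [hblk]
    rcases le_total (g / (1 + 3 * δ)) (c₀ * t) with hc | hc
    · have hRv : R = g / (1 + 3 * δ) := by rw [hR, min_eq_left hc]
      rw [hRv]
      calc 2 ^ ℓ * (h / 2 ^ k₀) ≤ g * (δ / (1 + 3 * δ)) := mul_le_mul hℓg hδ₁a hδ₁0 hg0.le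
        _ = δ * (g / (1 + 3 * δ)) := by ring
    · have hRv : R = c₀ * t := by rw [hR, min_eq_right hc]
      rw [hRv]
      calc 2 ^ ℓ * (h / 2 ^ k₀) ≤ (2 * κ ^ 2 * t) * (h / 2 ^ k₀) := mul_le_mul_of_nonneg_right (hℓg.trans hg2) hδ₁0
        _ = t * (h / 2 ^ k₀ * (2 * κ ^ 2)) := by ring
        _ ≤ t * (δ * c₀) := mul_le_mul_of_nonneg_left hδ₁b ht0.le
        _ = δ * (c₀ * t) := by ring

/-- **Node increments along a block.** See the module docstring. `hNode` is the digested node law; the admissibility of the node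
window over the whole block is `node_window`. [folklore] -/
theorem node_increment (ξ v : Fin N → ℝ → E3) (M : Fin N → ℝ) {κ δ C c₀ Λ h T TL : ℝ} {k₀ : ℕ} (ζ rmin : ℝ → ℝ)
    (hNode : ∀ (t R : ℝ) (c : E3) (A : Finset (Fin N)), TL ≤ t → 0 < R → R ≤ c₀ * t →
      min (rmin t / (2 * (1 + 3 * δ))) (c₀ * t) ≤ R → ‖c‖ ≤ κ ^ 2 * t →
      (∀ j ∈ A, ‖ξ j t - c‖ ≤ (1 - 2 * δ) * R) → (∀ j ∉ A, (1 + 2 * δ) * R ≤ ‖ξ j t - c‖) →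
      ∀ s' ∈ Set.Icc t (t + δ * R),
        ‖∑ j ∈ A, (M j * (√(1 - ‖v j s'‖ ^ 2))⁻¹) • v j s' - ∑ j ∈ A, (M j * (√(1 - ‖v j t‖ ^ 2))⁻¹) • v j t‖ ≤
          3 * (C * ((s' - t) * (R ^ (3 / 2 : ℝ))⁻¹) + ζ t + ζ s'))
    (hC : 0 ≤ C) (hδ : 0 < δ) (hδ1 : δ ≤ 1 / 10) (hΛ2 : 2 ≤ Λ) (hΛκ : 2 * κ ^ 2 ≤ Λ * ((1 - 2 * δ) * c₀)) (hc₀ : 0 < c₀)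
    (hh0 : 0 ≤ h) (hT : 0 < T) (hTL : TL ≤ T)
    (hδ₁a : h / 2 ^ k₀ ≤ δ / (1 + 3 * δ)) (hδ₁b : h / 2 ^ k₀ * (2 * κ ^ 2) ≤ δ * c₀)
    (hcone : ∀ (m : ℕ) (x : Fin N), ‖ξ x (T + m * h)‖ ≤ κ ^ 2 * (T + m * h))
    (hrmin : ∀ (m : ℕ) (x y : Fin N), x ≠ y → rmin (T + m * h) ≤ ‖ξ x (T + m * h) - ξ y (T + m * h)‖)
    {B : Finset (Fin N)} (hBne : B.Nonempty) {ℓ : ℕ} (hk₀ : k₀ ≤ ℓ) {s : ℕ} {D g : ℝ}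
    (hD : ∀ x ∈ B, ∀ y ∈ B, ‖ξ x (T + s * h) - ξ y (T + s * h)‖ ≤ D)
    (hg : ∀ x ∈ B, ∀ z ∈ univ \ B, g ≤ ‖ξ x (T + s * h) - ξ z (T + s * h)‖)
    (hnear : ∃ x₀ ∈ B, ∃ z₀ ∈ univ \ B, ‖ξ x₀ (T + s * h) - ξ z₀ (T + s * h)‖ < 2 * g)
    (hgap : Λ * D < g) (hℓg : (2 : ℝ) ^ ℓ ≤ g) {i' : ℕ} (h1 : s ≤ i') (h2 : i' ≤ s + 2 ^ (ℓ - k₀)) :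
    ‖∑ j ∈ B, (M j * (√(1 - ‖v j (T + i' * h)‖ ^ 2))⁻¹) • v j (T + i' * h) -
        ∑ j ∈ B, (M j * (√(1 - ‖v j (T + s * h)‖ ^ 2))⁻¹) • v j (T + s * h)‖ ≤
      3 * (C * ((2 : ℝ) ^ (ℓ - k₀) * h * ((min (g / (1 + 3 * δ)) (c₀ * (T + s * h))) ^ (3 / 2 : ℝ))⁻¹) +
        ζ (T + s * h) + ζ (T + i' * h)) := by
  obtain ⟨x, hx⟩ := hBne
  obtain ⟨hR0, hRc₀, hRlo, hcn, hin, hout, hdur⟩ :=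
    node_window ξ rmin hδ hδ1 hΛ2 hΛκ hc₀ hh0 hT hδ₁a hδ₁b hcone hrmin hx hk₀ hD hg hnear hgap hℓg
  set t : ℝ := T + s * h with ht
  set R : ℝ := min (g / (1 + 3 * δ)) (c₀ * t) with hR
  have hts : TL ≤ t := hTL.trans (by rw [ht]; exact le_add_of_nonneg_right (by positivity))
  have hsi : (s : ℝ) * h ≤ i' * h := mul_le_mul_of_nonneg_right (by exact_mod_cast h1) hh0
  have hdt : T + i' * h - t ≤ (2 : ℝ) ^ (ℓ - k₀) * h := by
    have : ((i' : ℕ) : ℝ) ≤ ((s + 2 ^ (ℓ - k₀) : ℕ) : ℝ) := by exact_mod_cast h2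
    push_cast at this
    rw [ht]; nlinarith
  have hmem : T + i' * h ∈ Set.Icc t (t + δ * R) := by
    constructor
    · rw [ht]; linarith
    · linarith
  have hlaw := hNode t R (ξ x t) B hts hR0 hRc₀ hRlo hcn hin hout (T + i' * h) hmem
  refine hlaw.trans ?_
  have hRinv : 0 ≤ (R ^ (3 / 2 : ℝ))⁻¹ := by positivity
  have := mul_le_mul_of_nonneg_right hdt hRinv
  nlinarith [mul_le_mul_of_nonneg_left this hC]

/-- Registered one-line form of `scale_flux_le` (scale matching of lever against flux). [folklore] -/
theorem scale_flux_le_of_min : ∀ {x g G a b : ℝ}, 0 < x → x ≤ g → g ≤ G → 0 < a → 0 < b → x * ((min (g * a) b) ^ (3 / 2 : ℝ))⁻¹ ≤ ((a ^ (3 / 2 : ℝ))⁻¹) * (√g)⁻¹ + G * (b ^ (3 / 2 : ℝ))⁻¹ :=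
  fun hx hxg hgG ha hb ↦ scale_flux_le hx hxg hgG ha hb

end Summit.FinalStateConjecture.FinalStateConjecture.Theorems.SublinearIsFree.Virial

end
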